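import Summits.QuantumFields.YangMills.Theorems.BalabanUVNodesK0AllTorusOfStepTokensGuardedZBLam
import Summits.QuantumFields.YangMills.Theorems.BalabanUVNodesN07RecordDomainsAdm22
import Literature.MathematicalPhysics.QuantumFieldTheory.Balaban1983to89.Node00.CriticalOnFibreTopGuardedBPrint

/-!
# K0⁷ AT PRINT's DATA PREDICATE (7): the `hDat` transfer of `…K0AllTorusOfStepTokensGuardedZBLam` DISCHARGED at `Dat := dataSmall7LamTopOf F 2` — the V23-shaped body with ONLY the
# Stage-2 seam `hseam` left displayed

Cell `pub-ymgap`, seat `pub-ymgap-k0-s1-w1` g9 (K0⁷ **stmt-QuantumFields-20541**; (E1)∕(iii-b) Stage 3; director-ym №339 (α) «the (7) data side moves to print's range too», №346∕№353).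
`--kind proof --supports stmt-QuantumFields-20541 --as helper` (count-neutral).  THEOREMS ONLY (0 `def`, 0 `sorry`).  NEW additive leaf.

WHY.  `…ZBLam` §5 leaves two hypotheses displayed: the seam `hseam` (one line AFTER the Stage-2 seam edit) and the data transfer `hDat` from the support's reading-(b) clause
`Sect2.DataSmall7PTop` to the data predicate the V23 texts will carry.  For print's (7) — def-Y's §7′ `Sect2.DataSmall7LamTop`, as the `TopData` plug `dataSmall7LamTopOf F N` of P0
(`Node00/CriticalOnFibreTopGuardedBPrint`) — the transfer HOLDS at every (2.18) index of record on a torus-compatible prefix: P0's `dataSmall7LamTopOf_of_seq` needs `n ≤ m + K` (from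
`n ≤ p.K`) and block saturation of `s.Ω`, which is k0-s1-w3's∕n07's `blockSat_seqOfRecord` from the grid numerics `PartCompat₁₃` (= `dCubeSide … ∣ sitesPerDir 0`).  So at print's datum
AND print's data predicate the K0⁷ body is conditional on `hseam` alone (plus the three stub texts).

WHAT IS PROVED.  `hDat_dataSmall7LamTopOf` (the transfer, every `F`, θ-generic) and ★★★ `record13SepCoPHBody_of_stubs1GBPrint_2P_3A'GBPrintZB_lam (hseam) (h1GB) (h2P) (h3A'GB)` — `…ZBLam` §5 at
`DatF := fun F => dataSmall7LamTopOf F 2` with `hDat` discharged.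
HONEST SCOPE.  Bookkeeping; CONDITIONAL on `hseam` (NOT in the tree before the seam edit) and on CANDIDATE stub texts (V23 NOT registered); nothing of Bałaban asserted; `stub_prop8StepCoPGridG13` ∕
K0⁷ NOT closed; N07 NOT discharged; counts unmoved (typed 28∕28 · discharged 8∕28); R4 = conditional finite-𝕋⁴ rung `BalabanLadder.UV` only — NOT continuum ∕ ℝ⁴ ∕ OS; the Yang–Mills mass
gap (Clay) is NOT proved by any of this.  No `def`, `instance`, `notation`, `sorry`.

References: [Balaban1985Variational] (7) p.278, Thm 1 (8)–(9) p.279, Prop. 8 p.304; [Balaban1984PropagatorsII] (2.3) p.224; [Balaban1988Convergent] (2.1)–(2.2) p.254, (2.18) p.257, Thm 1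
p.262; [Balaban1985RegularSpaces] Prop. 6 p.99; [Balaban1987RG1] (0.1) p.251, Thm 1 p.259.
-/

noncomputable section

open MeasureTheory
open scoped Matrix.Norms.L2Operator

namespace Summit.QuantumFields.YangMills.Theorems.K0AllTorusOfStepTokensGuardedZBLam

open Literature.MathematicalPhysics.QuantumFieldTheory.Balaban1983to89
open Literature.MathematicalPhysics.QuantumFieldTheory.Balaban1983to89.Node00
open Literature.MathematicalPhysics.QuantumFieldTheory.Balaban1983to89.T4Continuum
open Literature.MathematicalPhysics.QuantumFieldTheory.Balaban1983to89.FlowStep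
open Literature.MathematicalPhysics.QuantumFieldTheory.Balaban1983to89.B15DeterminingSets
open Literature.MathematicalPhysics.QuantumFieldTheory.Balaban1983to89.B8LeafModelZd (ZdIdx)
open Summit.QuantumFields.YangMills.BalabanUVNodes.N07RecordDomainsAdm22 (blockSat_seqOfRecord)

/-- **THE DATA TRANSFER AT PRINT's (7)**: on every prefix `(p, n, s)` with `n ≤ p.K` and torus-compatible 𝐃-partitions (`PartCompat₁₃`), the support's reading-(b) clause
`Sect2.DataSmall7PTop` gives print's `dataSmall7LamTopOf F N` (P0 `dataSmall7LamTopOf_of_seq`; saturation from `blockSat_seqOfRecord`) — the `hDat` hypothesis of `…ZBLam` at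
`Dat := dataSmall7LamTopOf F N`, for every Stage-13 parameter. [cite: Balaban1985Variational, (7) p.278; Balaban1984PropagatorsII, (2.3) p.224; Balaban1988Convergent, (2.1)–(2.2) p.254, (2.18) p.257] -/
theorem hDat_dataSmall7LamTopOf (F : T4Family) (N : ℕ) [NeZero N] (θ : Stage13Params F N) (p : B12.RunParams) (n : ℕ)
    (s : SeqOfRecord F θ.ν θ.τ9.M (gOfRecord₁₃ F N θ p) p.K n) (δ : ℕ → ℝ) (W : MSField (F.P p.K) (SU N)) (hn : n ≤ p.K) (hpc : PartCompat₁₃ F N θ p n)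
    (h7 : Sect2.DataSmall7PTop (avOfRecord F N p.K) s.Ω (suppDomOfRecord F θ.ν p.K s.Ω) n δ W) :
    dataSmall7LamTopOf F N p.K s.Ω (suppDomOfRecord F θ.ν p.K s.Ω) n δ W := by
  have hk : n ≤ (F.P p.K).m + (F.P p.K).K := by show n ≤ F.m + p.K; omega
  exact dataSmall7LamTopOf_of_seq s hk (blockSat_seqOfRecord F θ.ν θ.τ9.M (gOfRecord₁₃ F N θ p) p.K n hk s hpc) h7

variable {Efl logz : B12.RunParams → ℕ → ℝ}

/-- **★★★ K0⁷'s BODY AT EVERY FAMILY AT PRINT's DATUM AND PRINT's DATA PREDICATE, CONDITIONAL ON THE STAGE-2 SEAM ONLY** (plus the three CANDIDATE stub texts): `…ZBLam`'s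
`record13SepCoPHBody_of_stubs1GB_2P_3A'GBZB_lam` at `DatF := fun F => dataSmall7LamTopOf F 2`, `hDat` discharged by `hDat_dataSmall7LamTopOf`.  After the seam edit `hseam` is
`fun F θ p n s W => UbgOfRecord₁₃CoP_succ …` and this is the door a registered V23 skeleton's `…_of h1 h2 h3` cites.  CONDITIONAL; K0⁷ NOT closed; nothing of Bałaban asserted.
[cite: Balaban1985Variational, Thm 1 (8)–(9) p.279, (7) p.278, Prop. 8 p.304, p.304 lines 1–2; Balaban1985RegularSpaces, Prop. 6 p.99; Balaban1984PropagatorsII, (2.3) p.224; Balaban1988Convergent, Thm 1 p.262, (2.1) p.254, (2.18) p.257; Balaban1987RG1, Thm 1 p.259, (0.1) p.251] -/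
theorem record13SepCoPHBody_of_stubs1GBPrint_2P_3A'GBPrintZB_lam
    (hseam : ∀ (F : T4Family) (θ : Stage13Params F 2) (p : B12.RunParams) (n : ℕ) (s : SeqOfRecord F θ.ν θ.τ9.M (gOfRecord₁₃ F 2 θ p) p.K (n + 1)) (W : MSField (F.P p.K) (SU 2)),
      UbgOfRecord₁₃CoP F 2 θ p (n + 1) s W = UbgMSCoPOfRecordB F 2 θ.ν θ.τ9.M (gOfRecord₁₃ F 2 θ p) p.K (n + 1) s W)
    (h1G : ∀ F : T4Family, ∃ (c c₀ c₁ : ℕ) (B₃ a₀ a₁ : ℝ), 2 * (F.L : ℝ) ^ 2 ≤ B₃ ∧ 0 < a₀ ∧ 0 < a₁ ∧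
      Prop8RegSepTopStepGB F 2 (fun ν K Ω => suppDomOfRecord F ν K Ω) (fun ν M g K k _s => c ≤ ν.M₁ ∧ k + c₀ ≤ F.m + K ∧ F.L ^ c₁ ∣ M ∧
      ∀ i, 1 ≤ i → i ≤ k → dCubeSide (F.P K).L M (RkOfRecord (F.P K).L ν.r (g i)) i ∣ (F.P K).sitesPerDir 0) (lamDatum F) (dataSmall7LamTopOf F 2) B₃ a₀ a₁)
    (h2P : ∀ F : T4Family, ∃ (ρ₀ : ℕ) (B₁ c₁ : ℝ), 1 ≤ ρ₀ ∧ 0 ≤ B₁ ∧ 0 < c₁ ∧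
      (letI : CStarAlgebra (MatA 2) := {}; B8.Prop6Printed 4 (F.L : ℝ) B₁ c₁ (fun i : ZdIdx 4 F.L => zdCubP (MatA 2) F.L ρ₀ i)))
    (h3A'G : ∀ (F : T4Family) (j c c₀ c₁ : ℕ) (B₃ B₃' a₀ a₁ : ℝ), c ≤ F.L ^ j → c₀ ≤ j + 1 → c₁ ≤ j → 2 * (F.L : ℝ) ^ 2 ≤ B₃ → 0 < B₃' → 0 < a₀ → 0 < a₁ →
      VariationalThm1RegSepCoP7MGB F 2 (fun ν M g K k _s => c ≤ ν.M₁ ∧ k + c₀ ≤ F.m + K ∧ F.L ^ c₁ ∣ M ∧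
      ∀ i, 1 ≤ i → i ≤ k → dCubeSide (F.P K).L M (RkOfRecord (F.P K).L ν.r (g i)) i ∣ (F.P K).sitesPerDir 0) (lamDatum F) (dataSmall7LamTopOf F 2) B₃ a₀ a₁ →
      Gauge9RegSepTopStepGB F 2 (fun ν K Ω => suppDomOfRecord F ν K Ω) (F.L ^ j) (fun ν M g K k _s => c ≤ ν.M₁ ∧ k + c₀ ≤ F.m + K ∧ F.L ^ c₁ ∣ M ∧
      ∀ i, 1 ≤ i → i ≤ k → dCubeSide (F.P K).L M (RkOfRecord (F.P K).L ν.r (g i)) i ∣ (F.P K).sitesPerDir 0) (lamDatum F) (dataSmall7LamTopOf F 2) B₃ B₃' a₀ a₁ →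
      ∃ γ₀ ε₀ ε₂₉ β' : ℝ, 0 < γ₀ ∧ 0 < ε₀ ∧ 0 < ε₂₉ ∧
        BetaLowerH (-β') γ₀ (betaOfRecord₁₃ F 2 (theta13OfThm1CCMWZB F 2 j (1 / 2) a₀ ε₀ ε₂₉ B₃ B₃' a₀ a₁ Efl logz)) ∧
        BetaUpperH β' γ₀ (betaOfRecord₁₃ F 2 (theta13OfThm1CCMWZB F 2 j (1 / 2) a₀ ε₀ ε₂₉ B₃ B₃' a₀ a₁ Efl logz))) :
    ∀ F : T4Family, ∃ θ : Stage13HParams F 2, θ.Provisos₁₃SepCoPH F 2 ∧ (θ.ZhUnity F 2 ∧ θ.SlotsNondegenerate₁₃ F 2) ∧ θ.Admissible F 2 :=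
  record13SepCoPHBody_of_stubs1GB_2P_3A'GBZB_lam (DatF := fun F => dataSmall7LamTopOf F 2)
    (fun F θ p n s δ W hn hpc h7 => hDat_dataSmall7LamTopOf F 2 θ p n s δ W hn hpc h7) hseam h1G h2P h3A'G

end Summit.QuantumFields.YangMills.Theorems.K0AllTorusOfStepTokensGuardedZBLam

end
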